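import Literature.Geometry.Kaehler.RiemannianHodge
import HarnessLib

/-!
# Harmonic forms and linearity of the Hodge Laplacian (Warner §6.1, Def. 6.7)

This file accompanies the named fact `Literature.Geometry.Kaehler.mem_harmonicForms_iff`
(`Literature/Geometry/Kaehler/RiemannianHodge.lean`),
"`α ∈ harmonicForms o h ↔ IsHarmonicForm o h α`", i.e. "the harmonic `k`-forms
`{α smooth | Δα = 0}` already form a linear subspace" (Warner, *Foundations of Differentiable
Manifolds and Lie Groups*, 6.1: "`Δ = δd + dδ` … is a linear operator on `E^p(M)`", and
Def. 6.7: `H^p = {ω ∈ E^p(M) : Δω = 0}`). It proves what is true of that statement and reduces the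
rest to the two upstream named facts that carry the analysis.

## Status of `mem_harmonicForms_iff` (why it is not discharged outright)

In Warner the Riemannian metric is `C^∞`. The interim *theorem* `mem_harmonicForms_iff` lived in
a section with the instances `[IsManifold I ∞ M]`,
`[IsContinuousRiemannianBundle E (fun x : M ↦ TangentSpace I x)]`,
`[IsContMDiffRiemannianBundle I ∞ E (fun x : M ↦ TangentSpace I x)]` (smooth metric); the M5
rewrite turned it into `def mem_harmonicForms_iff : Prop`, and a `def` does not pick up unused
section instances, so the vendored fact quantifies over Riemannian bundle metrics of *no
regularity at all* (`#check @mem_harmonicForms_iff` binds only `[RiemannianBundle _]`).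
For such metrics the universal closure `∀ …, mem_harmonicForms_iff o` is false: the exterior
derivative `mextDeriv` is `fderivWithin`-based, hence `0` (a junk value) wherever a form is not
differentiable, and additivity of `Δ = dδ + δd` on smooth forms is lost because `⋆` of a smooth
form need not be differentiable. Concretely, on `M = ℝ²` with the metric `a dx² + a⁻¹ dy²`,
`a = exp (x · 𝟙_ℚ(y))` (unit determinant, so the volume form is the constant `dx ∧ dy` and the
hypothesis `ho` holds), the smooth functions `y + x²/2` and `-y` are "harmonic" (`⋆d` of each has
the nowhere-differentiable coefficient `∓a`, so `d⋆d` of each is the junk value `0` everywhere),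
while their sum `x²/2` is not (`⋆d(x²/2) = (x/a) dy` is differentiable along `x = 0` with
`d⋆d(x²/2) = dx ∧ dy` there, whence `Δ(x²/2)(0, y₀) = -1`): `x²/2 ∈ harmonicForms` but
`¬ IsHarmonicForm (x²/2)`. The same dropped-instance defect affects the sibling facts
`isSmoothForm_hodgeStar`, `isSmoothForm_mcoderiv`, `mcoderiv_mcoderiv` and
`isHarmonicForm_iff_mextDeriv_eq_zero_and_mcoderiv_eq_zero` of that file. For every *smooth*
metric, however, `mem_harmonicForms_iff o` holds; this file isolates exactly what it rests on.

## Contents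

* Unconditional algebra: `mcoderiv_smul`, `hodgeLaplacian_smul`, `IsHarmonicForm.smul`
  (so `harmonicForms ⊇ {harmonic}` and closure under scalars need nothing), and `mcoderiv_add`
  (additivity of `δ` given smoothness of `⋆α`, `⋆β`).
* The reduction (relative discharge): `hodgeLaplacian_add_of_facts` and
  `mem_harmonicForms_iff_of_facts` derive additivity of `Δ` on smooth forms, hence
  `mem_harmonicForms_iff o`, from chart independence of `d` (`inChart_mextDeriv I M ℝ`, which
  gives smoothness of `dα`) and smoothness of the Hodge star of smooth forms in every degree
  (`isSmoothForm_hodgeStar o`). Both hold for smooth metrics (Warner, 2.20 and 6.1); the second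
  is exactly what fails for rough ones.

Nothing here is deep: Warner's one-line "Δ is a linear operator on `E^p(M)`" is the content.
No new named fact is introduced.

## References

* F. W. Warner, *Foundations of Differentiable Manifolds and Lie Groups*, GTM 94 (1983), 6.1
  (p. 220) and Def. 6.7 (p. 222).
-/

noncomputable section

open scoped Manifold ContDiff Topology
open Bundle Module

namespace Literature.Geometry.Kaehler

variable {E : Type*} [NormedAddCommGroup E] [NormedSpace ℝ E] {n : ℕ} [Fact (finrank ℝ E = n)]
  {H : Type*} [TopologicalSpace H] {I : ModelWithCorners ℝ E H}
  {M : Type*} [TopologicalSpace M] [ChartedSpace H M] [FiniteDimensional ℝ E]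
  [RiemannianBundle (fun x : M ↦ TangentSpace I x)] {k m : ℕ}
  (o : (x : M) → Orientation ℝ (TangentSpace I x) (Fin n))

/-! ### Unconditional algebra of `δ` and `Δ` -/

/-- The codifferential commutes with scalars, with no smoothness hypothesis (`⋆` is linear and
`d (c • β) = c • d β` unconditionally, `mextDeriv_smul`). Warner (1983), 6.1. [cite: WarnerGTM94, 6.1] -/
theorem mcoderiv_smul (h : (k + 1) + m = n) (c : ℝ) (α : MForm I M ℝ (k + 1)) :
    mcoderiv o h (c • α) = c • mcoderiv o h α := by
  simp only [mcoderiv, map_smul, mextDeriv_smul]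
  rw [smul_comm]

/-- The codifferential is additive on forms whose Hodge stars are smooth:
`δ(α + β) = δα + δβ` (`d` is additive on smooth forms, `mextDeriv_add`). Warner (1983), 6.1. [cite: WarnerGTM94, 6.1] -/
theorem mcoderiv_add (h : (k + 1) + m = n) {α β : MForm I M ℝ (k + 1)}
    (hα : IsSmoothForm (MForm.hodgeStar o h α)) (hβ : IsSmoothForm (MForm.hodgeStar o h β)) :
    mcoderiv o h (α + β) = mcoderiv o h α + mcoderiv o h β := by
  simp only [mcoderiv, map_add, mextDeriv_add hα hβ, smul_add]

/-- The Hodge Laplacian commutes with scalars, with no smoothness hypothesis: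
`Δ (c • α) = c • Δ α`. Warner (1983), 6.1. [cite: WarnerGTM94, 6.1] -/
theorem hodgeLaplacian_smul (h : k + m = n) (c : ℝ) (α : MForm I M ℝ k) :
    hodgeLaplacian o k m h (c • α) = c • hodgeLaplacian o k m h α := by
  rcases k with - | k <;> rcases m with - | m
  · simp [hodgeLaplacian]
  · simp only [hodgeLaplacian, mextDeriv_smul, mcoderiv_smul]
  · simp only [hodgeLaplacian, mcoderiv_smul, mextDeriv_smul]
  · simp only [hodgeLaplacian, mextDeriv_smul, mcoderiv_smul, smul_add]

/-- Scalar multiples of harmonic forms are harmonic (unconditionally). Warner (1983), 6.1 / 6.7. [cite: WarnerGTM94, 6.1 and Def. 6.7] -/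
theorem IsHarmonicForm.smul (h : k + m = n) {α : MForm I M ℝ k} (hα : IsHarmonicForm o h α)
    (c : ℝ) : IsHarmonicForm o h (c • α) :=
  ⟨hα.1.smul c, by rw [hodgeLaplacian_smul, hα.2, smul_zero]⟩

/-! ### Reduction to the two upstream facts -/

section Facts

variable [IsManifold I ∞ M]

/-- Smoothness of `δα` for smooth `α`, from chart independence of `d` (`hd`, giving smoothness of
`d`) and smoothness of `⋆` on smooth forms (`hs`). Warner (1983), 6.1. [cite: WarnerGTM94, 6.1] -/
theorem isSmoothForm_mcoderiv_of_facts (hd : inChart_mextDeriv I M ℝ)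
    (hs : ∀ {k m : ℕ}, isSmoothForm_hodgeStar (k := k) (m := m) o)
    (ho : IsSmoothForm (riemannianVolumeForm o)) (h : (k + 1) + m = n) {α : MForm I M ℝ (k + 1)}
    (hα : IsSmoothForm α) : IsSmoothForm (mcoderiv o h α) :=
  (hs ho _ (isSmoothForm_mextDeriv hd (hs ho h hα))).smul _

/-- **Additivity of the Hodge Laplacian on smooth forms**, `Δ(α + β) = Δα + Δβ`, from the two
upstream facts: chart independence of `d` (`hd`) and smoothness of `⋆` on smooth forms (`hs`).
This is Warner's "`Δ` is a linear operator on `E^p(M)`" (1983, 6.1, p. 220). [cite: WarnerGTM94, 6.1] -/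
theorem hodgeLaplacian_add_of_facts (hd : inChart_mextDeriv I M ℝ)
    (hs : ∀ {k m : ℕ}, isSmoothForm_hodgeStar (k := k) (m := m) o)
    (ho : IsSmoothForm (riemannianVolumeForm o)) (h : k + m = n) {α β : MForm I M ℝ k}
    (hα : IsSmoothForm α) (hβ : IsSmoothForm β) :
    hodgeLaplacian o k m h (α + β) = hodgeLaplacian o k m h α + hodgeLaplacian o k m h β := by
  rcases k with - | k <;> rcases m with - | m
  · simp [hodgeLaplacian]
  · simp only [hodgeLaplacian]
    rw [mextDeriv_add hα hβ, mcoderiv_add o _ (hs ho _ (isSmoothForm_mextDeriv hd hα))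
      (hs ho _ (isSmoothForm_mextDeriv hd hβ))]
  · simp only [hodgeLaplacian]
    rw [mcoderiv_add o _ (hs ho _ hα) (hs ho _ hβ),
      mextDeriv_add (isSmoothForm_mcoderiv_of_facts o hd hs ho _ hα)
        (isSmoothForm_mcoderiv_of_facts o hd hs ho _ hβ)]
  · simp only [hodgeLaplacian]
    rw [mcoderiv_add o _ (hs ho _ hα) (hs ho _ hβ),
      mextDeriv_add (isSmoothForm_mcoderiv_of_facts o hd hs ho _ hα)
        (isSmoothForm_mcoderiv_of_facts o hd hs ho _ hβ),
      mextDeriv_add hα hβ,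
      mcoderiv_add o _ (hs ho _ (isSmoothForm_mextDeriv hd hα))
        (hs ho _ (isSmoothForm_mextDeriv hd hβ))]
    abel

/-- Sums of harmonic forms are harmonic, given the two upstream facts. Warner (1983), 6.1 / 6.7. [cite: WarnerGTM94, 6.1 and Def. 6.7] -/
theorem IsHarmonicForm.add_of_facts (hd : inChart_mextDeriv I M ℝ)
    (hs : ∀ {k m : ℕ}, isSmoothForm_hodgeStar (k := k) (m := m) o)
    (ho : IsSmoothForm (riemannianVolumeForm o)) (h : k + m = n) {α β : MForm I M ℝ k}
    (hα : IsHarmonicForm o h α) (hβ : IsHarmonicForm o h β) : IsHarmonicForm o h (α + β) :=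
  ⟨hα.1.add hβ.1, by
    rw [hodgeLaplacian_add_of_facts o hd hs ho h hα.1 hβ.1, hα.2, hβ.2, add_zero]⟩

/-- **Relative discharge of `mem_harmonicForms_iff`.** Given chart independence of `d`
(`inChart_mextDeriv I M ℝ`) and smoothness of the Hodge star of smooth forms in every degree
(`isSmoothForm_hodgeStar o`), membership in `harmonicForms o h` is being harmonic: the harmonic
forms are closed under `0`, `+`, `•`, so their span is themselves (`Submodule.span_induction`).
Warner (1983), 6.1 and Def. 6.7. Both hypotheses hold for smooth metrics; for metrics of no
regularity `hs` (and the conclusion) can fail, see the module docstring. [cite: WarnerGTM94, 6.1 and Def. 6.7] -/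
theorem mem_harmonicForms_iff_of_facts (hd : inChart_mextDeriv I M ℝ)
    (hs : ∀ {k m : ℕ}, isSmoothForm_hodgeStar (k := k) (m := m) o) :
    mem_harmonicForms_iff (k := k) (m := m) o := by
  intro ho h α
  refine ⟨fun hα ↦ ?_, fun hα ↦ subset_harmonicForms o h hα⟩
  induction hα using Submodule.span_induction with
  | mem x hx => exact hx
  | zero => exact isHarmonicForm_zero o h
  | add x y _ _ hx hy => exact hx.add_of_facts o hd hs ho h hy
  | smul c x _ hx => exact hx.smul o h c

end Facts

end Literature.Geometry.Kaehler
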